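import Literature.Probability.RandomPlanarGeometry.SAWTriangularDetourSurgery
import Literature.Probability.Percolation.BrickHex
import HarnessLib

/-!
# One-step monotonicity with fixed endpoint on the triangular lattice: `c_N(0,x) ≤ 4 c_{N+1}(0,x)` for large `N`

Topic `Literature/Probability/RandomPlanarGeometry` (continues `SAWTriangularDetourSurgery.lean`: the list model `triSL N`
of the `N`-step self-avoiding walks of `𝕋` from `0`, vertex access `ω.getD j 0`, the detour slots `triSlots` and the
insertion `triIns`; `BrickHex.lean`: `triGraph_adj_iff_brick`).

Source: N. Madras, G. Slade, *The Self-Avoiding Walk* (1993), Lemma 7.3.3, p. 247: on `ℤ^d`, `c_{N+2}(0,x) ≥ c_N(0,x)`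
for `N` large of the parity of `‖x‖₁` — at the first time `j` of maximal sup-norm (an interior time once
`N > (2A+1)^d`), replace the step out of `ω(j)` by three steps through the free half-space; the two added points
"have larger norm than any other points of `ω*` and hence are unambiguously determined".  This is hypothesis (ii)
of the ratio limit theorem for `c_N(0,x)` (Theorem 7.3.4(b)).  On the triangular lattice ONE extra step suffices
(no parity): this file proves

  **`card_triSLx_le_four_mul : ∀ x, ∀ N, (2A+1)² < N+1 → #S_N(x) ≤ 4 · #S_{N+1}(x)`**, `A = max(|2x₀+x₁|, |x₀+2x₁|)`,

where `S_N(x)` (`triSLx N x`) are the `N`-step self-avoiding walks of `𝕋` from `0` to `x`.  Mechanism (not located in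
print for `𝕋`; the `ℤ^d` two-step version is the cited lemma): the two brick heights `h₁ = 2x₀ + x₁`, `h₂ = x₀ + 2x₁`
determine a site, so a walk with more than `(2A+1)²` vertices leaves the box `|h₁|, |h₂| ≤ A` — one of the four
signed heights `±h₁, ±h₂` exceeds both endpoint values somewhere, hence is maximal at an INTERIOR vertex `ω(j)`
(height `D`).  Every step changes each height by `±1` or `±2`.  If the step out of `ω(j)` drops the height by `1`,
the edge `(ω(j), ω(j+1))` has a free apex at height `D + 1` (namely `ω(j+1) + v`, `v` the frame's `+2`-step); if it
drops by `2` (the step `−v`), the step INTO `ω(j)` rises by `1` (a rise by `2` would be `+v` and give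
`ω(j−1) = ω(j+1)`) and the edge `(ω(j−1), ω(j))` has the free apex `ω(j−1) + v` at height `D + 1`.  Inserting that
apex (the tree's `triIns`) keeps both endpoints; the inserted vertex is the unique highest vertex of the new walk,
so the map is injective on each of the four classes — whence the factor `4`.

## Main statements (namespace `Literature.Probability.RandomPlanarGeometry.SAW`)

* `triSLx N x` — the walks of `triSL N` ending at `x`; `TriFrame` — the four signed brick heights with their
  `+2`-steps (`frameH1`, `frameH1neg`, `frameH2`, `frameH2neg`);
* `TriEndpointMono.exists_apex` — the free apex above an interior height maximum;
* `TriEndpointMono.card_cls_le` — each class injects into `S_{N+1}(x)`;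
* **`card_triSLx_le_four_mul`** — `#S_N(x) ≤ 4 · #S_{N+1}(x)` for `(2A+1)² < N + 1`;
* `exists_card_triSLx_le_four_mul` — the `∃ N₀, ∀ N ≥ N₀` form (hypothesis (ii) of Madras–Slade Lemma 7.3.1 for
  `c_N(0,x)` on `𝕋`, with constant `1/4`).
-/

noncomputable section

open Finset
open Literature.Probability.LatticeModels Literature.Probability.Percolation SimpleGraph

namespace Literature.Probability.RandomPlanarGeometry.SAW

/-! ### Walks with a fixed endpoint -/

/-- `S_N(x)`: the `N`-step self-avoiding walks of `𝕋` from `0` whose last vertex is `x`.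
[cite: MadrasSlade1993, §1.1 (c_N(0,x))] -/
def triSLx (N : ℕ) (x : Site 2) : Finset (List (Site 2)) := (triSL N).filter fun ω => ω.getD N 0 = x

/-- Membership in `triSLx`. [cite: MadrasSlade1993, §1.1] -/
theorem mem_triSLx {N : ℕ} {x : Site 2} {ω : List (Site 2)} : ω ∈ triSLx N x ↔ ω ∈ triSL N ∧ ω.getD N 0 = x :=
  Finset.mem_filter

/-! ### Adjacency of `𝕋` relative to the origin -/

/-- `x ~ y` iff `0 ~ y − x`. [cite: Grimmett2018, §5.5] -/
theorem triGraph_adj_iff_adj_zero_sub (x y : Site 2) : triGraph.Adj x y ↔ triGraph.Adj 0 (y - x) := by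
  rw [triGraph_adj_iff_brick, triGraph_adj_iff_brick]
  simp only [brickX, Pi.sub_apply, Pi.zero_apply]
  omega

/-- Adjacency to the origin in coordinates: `0 ~ s` iff `s ∈ {±(1,0), ±(0,1), ±(1,−1)}`, written with
`2s₀ + s₁` and `s₁`. [cite: Grimmett2018, §5.5] -/
theorem triGraph_adj_zero_iff (s : Site 2) : triGraph.Adj 0 s ↔
    (s 1 = 0 ∧ (2 * s 0 + s 1 = 2 ∨ 2 * s 0 + s 1 = -2)) ∨
      ((s 1 = 1 ∨ s 1 = -1) ∧ (2 * s 0 + s 1 = 1 ∨ 2 * s 0 + s 1 = -1)) := by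
  rw [triGraph_adj_iff_brick]
  simp only [brickX, Pi.zero_apply, mul_zero, add_zero, zero_add]
  omega

/-- Two sites with the same coordinates are equal. [folklore] -/
private theorem site_eq {s t : Site 2} (h0 : s 0 = t 0) (h1 : s 1 = t 1) : s = t := by
  funext i
  fin_cases i
  · exact h0
  · exact h1

/-! ### Frames: a signed brick height and its `+2`-step -/

/-- A **frame** of `𝕋`: an additive height `g` taking the values `±1, ±2` on steps, with `g = ±2` exactly on the steps
`±v`, and the apex property: a step of height `−1` followed by `+v` (resp. `+1` followed by `−v`) is again a step.
The four instances are `±(2x₀ + x₁)` with `v = ±(1,0)` and `±(x₀ + 2x₁)` with `v = ±(0,1)`. [cite: Grimmett2018, §5.5] -/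
structure TriFrame where
  /-- the height -/
  g : Site 2 →+ ℤ
  /-- the step of height `+2` -/
  v : Site 2
  adj_v : triGraph.Adj 0 v
  g_v : g v = 2
  g_step : ∀ s, triGraph.Adj 0 s → g s = 1 ∨ g s = -1 ∨ g s = 2 ∨ g s = -2
  eq_v : ∀ s, triGraph.Adj 0 s → g s = 2 → s = v
  eq_neg_v : ∀ s, triGraph.Adj 0 s → g s = -2 → s = -v
  up : ∀ s, triGraph.Adj 0 s → g s = -1 → triGraph.Adj 0 (s + v)
  down : ∀ s, triGraph.Adj 0 s → g s = 1 → triGraph.Adj 0 (s - v)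

/-- The brick height `h₁ = 2x₀ + x₁` as an additive map. [cite: Grimmett2018, §5.5] -/
def gH1 : Site 2 →+ ℤ where
  toFun s := 2 * s 0 + s 1
  map_zero' := by simp
  map_add' a b := by simp only [Pi.add_apply]; ring

/-- The second brick height `h₂ = x₀ + 2x₁` as an additive map. [cite: Grimmett2018, §5.5] -/
def gH2 : Site 2 →+ ℤ where
  toFun s := s 0 + 2 * s 1
  map_zero' := by simp
  map_add' a b := by simp only [Pi.add_apply]; ring

/-- Value of `gH1`. [cite: Grimmett2018, §5.5] -/
@[simp] theorem gH1_apply (s : Site 2) : gH1 s = 2 * s 0 + s 1 := rfl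

/-- Value of `gH2`. [cite: Grimmett2018, §5.5] -/
@[simp] theorem gH2_apply (s : Site 2) : gH2 s = s 0 + 2 * s 1 := rfl

/-- The frame `(2x₀ + x₁, (1,0))`. [cite: Grimmett2018, §5.5] -/
def frameH1 : TriFrame where
  g := gH1
  v := ![1, 0]
  adj_v := by rw [triGraph_adj_zero_iff]; simp
  g_v := by simp
  g_step s hs := by rw [triGraph_adj_zero_iff] at hs; simp only [gH1_apply]; omega
  eq_v s hs h := by
    rw [triGraph_adj_zero_iff] at hs; simp only [gH1_apply] at h
    exact site_eq (by simp; omega) (by simp; omega)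
  eq_neg_v s hs h := by
    rw [triGraph_adj_zero_iff] at hs; simp only [gH1_apply] at h
    exact site_eq (by simp; omega) (by simp; omega)
  up s hs h := by
    rw [triGraph_adj_zero_iff] at hs ⊢; simp only [gH1_apply] at h
    simp only [Pi.add_apply, Matrix.cons_val_zero, Matrix.cons_val_one]; omega
  down s hs h := by
    rw [triGraph_adj_zero_iff] at hs ⊢; simp only [gH1_apply] at h
    simp only [Pi.sub_apply, Matrix.cons_val_zero, Matrix.cons_val_one]; omega

/-- The frame `(−(2x₀ + x₁), (−1,0))`. [cite: Grimmett2018, §5.5] -/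
def frameH1neg : TriFrame where
  g := -gH1
  v := ![-1, 0]
  adj_v := by rw [triGraph_adj_zero_iff]; simp
  g_v := by simp
  g_step s hs := by rw [triGraph_adj_zero_iff] at hs; simp only [AddMonoidHom.neg_apply, gH1_apply]; omega
  eq_v s hs h := by
    rw [triGraph_adj_zero_iff] at hs; simp only [AddMonoidHom.neg_apply, gH1_apply] at h
    exact site_eq (by simp; omega) (by simp; omega)
  eq_neg_v s hs h := by
    rw [triGraph_adj_zero_iff] at hs; simp only [AddMonoidHom.neg_apply, gH1_apply] at h
    exact site_eq (by simp; omega) (by simp; omega)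
  up s hs h := by
    rw [triGraph_adj_zero_iff] at hs ⊢; simp only [AddMonoidHom.neg_apply, gH1_apply] at h
    simp only [Pi.add_apply, Matrix.cons_val_zero, Matrix.cons_val_one]; omega
  down s hs h := by
    rw [triGraph_adj_zero_iff] at hs ⊢; simp only [AddMonoidHom.neg_apply, gH1_apply] at h
    simp only [Pi.sub_apply, Matrix.cons_val_zero, Matrix.cons_val_one]; omega

/-- The frame `(x₀ + 2x₁, (0,1))`. [cite: Grimmett2018, §5.5] -/
def frameH2 : TriFrame where
  g := gH2
  v := ![0, 1]
  adj_v := by rw [triGraph_adj_zero_iff]; simp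
  g_v := by simp
  g_step s hs := by rw [triGraph_adj_zero_iff] at hs; simp only [gH2_apply]; omega
  eq_v s hs h := by
    rw [triGraph_adj_zero_iff] at hs; simp only [gH2_apply] at h
    exact site_eq (by simp; omega) (by simp; omega)
  eq_neg_v s hs h := by
    rw [triGraph_adj_zero_iff] at hs; simp only [gH2_apply] at h
    exact site_eq (by simp; omega) (by simp; omega)
  up s hs h := by
    rw [triGraph_adj_zero_iff] at hs ⊢; simp only [gH2_apply] at h
    simp only [Pi.add_apply, Matrix.cons_val_zero, Matrix.cons_val_one]; omega
  down s hs h := by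
    rw [triGraph_adj_zero_iff] at hs ⊢; simp only [gH2_apply] at h
    simp only [Pi.sub_apply, Matrix.cons_val_zero, Matrix.cons_val_one]; omega

/-- The frame `(−(x₀ + 2x₁), (0,−1))`. [cite: Grimmett2018, §5.5] -/
def frameH2neg : TriFrame where
  g := -gH2
  v := ![0, -1]
  adj_v := by rw [triGraph_adj_zero_iff]; simp
  g_v := by simp
  g_step s hs := by rw [triGraph_adj_zero_iff] at hs; simp only [AddMonoidHom.neg_apply, gH2_apply]; omega
  eq_v s hs h := by
    rw [triGraph_adj_zero_iff] at hs; simp only [AddMonoidHom.neg_apply, gH2_apply] at h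
    exact site_eq (by simp; omega) (by simp; omega)
  eq_neg_v s hs h := by
    rw [triGraph_adj_zero_iff] at hs; simp only [AddMonoidHom.neg_apply, gH2_apply] at h
    exact site_eq (by simp; omega) (by simp; omega)
  up s hs h := by
    rw [triGraph_adj_zero_iff] at hs ⊢; simp only [AddMonoidHom.neg_apply, gH2_apply] at h
    simp only [Pi.add_apply, Matrix.cons_val_zero, Matrix.cons_val_one]; omega
  down s hs h := by
    rw [triGraph_adj_zero_iff] at hs ⊢; simp only [AddMonoidHom.neg_apply, gH2_apply] at h
    simp only [Pi.sub_apply, Matrix.cons_val_zero, Matrix.cons_val_one]; omega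

namespace TriEndpointMono

variable (F : TriFrame) {N : ℕ} {x : Site 2} {ω : List (Site 2)}

/-! ### The free apex above an interior height maximum -/

/-- **The free apex**: if the height `F.g` of `ω ∈ S_N` is maximal at an interior vertex `ω(j)` (`0 < j < N`), then
`ω` has a detour slot whose apex is strictly higher than every vertex of `ω`.
[cite: MadrasSlade1993, Lemma 7.3.3 (proof: the outer normal at the point of maximal norm)] -/
theorem exists_apex (hω : ω ∈ triSL N) {j : ℕ} (hj0 : 0 < j) (hjN : j < N)
    (hmax : ∀ i ≤ N, F.g (ω.getD i 0) ≤ F.g (ω.getD j 0)) :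
    ∃ p : ℕ × Site 2, p ∈ triSlots ω ∧ ∀ i ≤ N, F.g (ω.getD i 0) < F.g p.2 := by
  have hl := length_of_mem_triSL hω
  set D := F.g (ω.getD j 0) with hD
  -- a vertex strictly above `D` is not on the walk
  have hfree : ∀ z : Site 2, F.g z = D + 1 → z ∉ ω := by
    intro z hz hzω
    obtain ⟨i, hi, hiz⟩ := List.getElem_of_mem hzω
    rw [List.getElem_eq_getD 0] at hiz
    have := hmax i (by omega)
    rw [hiz, hz] at this
    omega
  -- the step out of `ω(j)`
  have hadj_out := adj_getD_of_mem_triSL hω (show j + 1 ≤ N by omega)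
  set w : Site 2 := ω.getD (j + 1) 0 - ω.getD j 0 with hw
  have hw0 : triGraph.Adj 0 w := (triGraph_adj_iff_adj_zero_sub _ _).1 hadj_out
  have hgw : F.g (ω.getD (j + 1) 0) = D + F.g w := by
    rw [hw, map_sub]; ring
  have hle_out := hmax (j + 1) (by omega)
  rcases F.g_step w hw0 with h1 | h1 | h1 | h1
  · exfalso; rw [hgw] at hle_out; omega
  · -- out-step of height `−1`: the apex `ω(j+1) + v`
    refine ⟨(j, ω.getD (j + 1) 0 + F.v), mem_triSlots.2 ⟨by omega, ?_, ?_, hfree _ ?_⟩, fun i hi => ?_⟩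
    · rw [triGraph_adj_iff_adj_zero_sub, show ω.getD (j + 1) 0 + F.v - ω.getD j 0 = w + F.v by rw [hw]; abel]
      exact F.up w hw0 h1
    · rw [triGraph_adj_iff_adj_zero_sub,
        show ω.getD (j + 1) 0 - (ω.getD (j + 1) 0 + F.v) = -F.v by abel]
      have h := (triGraph_adj_iff_adj_zero_sub F.v 0).1 F.adj_v.symm
      rwa [zero_sub] at h
    · rw [map_add, hgw, F.g_v, h1]; ring
    · have := hmax i hi
      rw [map_add, hgw, F.g_v, h1]; omega
  · exfalso; rw [hgw] at hle_out; omega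
  · -- out-step `−v`: use the step INTO `ω(j)`
    have hadj_in := adj_getD_of_mem_triSL hω (show (j - 1) + 1 ≤ N by omega)
    rw [show j - 1 + 1 = j by omega] at hadj_in
    set u : Site 2 := ω.getD j 0 - ω.getD (j - 1) 0 with hu
    have hu0 : triGraph.Adj 0 u := (triGraph_adj_iff_adj_zero_sub _ _).1 hadj_in
    have hgu : F.g (ω.getD (j - 1) 0) = D - F.g u := by
      rw [hu, map_sub]; ring
    have hle_in := hmax (j - 1) (by omega)
    rcases F.g_step u hu0 with h2 | h2 | h2 | h2
    · -- in-step of height `+1`: the apex `ω(j−1) + v`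
      refine ⟨(j - 1, ω.getD (j - 1) 0 + F.v), mem_triSlots.2 ⟨by omega, ?_, ?_, hfree _ ?_⟩, fun i hi => ?_⟩
      · rw [triGraph_adj_iff_adj_zero_sub, show ω.getD (j - 1) 0 + F.v - ω.getD (j - 1) 0 = F.v by abel]
        exact F.adj_v
      · rw [show j - 1 + 1 = j by omega, triGraph_adj_iff_adj_zero_sub,
          show ω.getD j 0 - (ω.getD (j - 1) 0 + F.v) = u - F.v by rw [hu]; abel]
        exact F.down u hu0 h2
      · rw [map_add, hgu, F.g_v, h2]; ring
      · have := hmax i hi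
        rw [map_add, hgu, F.g_v, h2]; omega
    · exfalso; rw [hgu] at hle_in; omega
    · -- in-step `+v` and out-step `−v`: `ω(j−1) = ω(j+1)`, impossible
      exfalso
      have huv := F.eq_v u hu0 h2
      have hwv := F.eq_neg_v w hw0 h1
      have heq : ω.getD (j - 1) 0 = ω.getD (j + 1) 0 := by
        have e1 : ω.getD (j - 1) 0 = ω.getD j 0 - u := by rw [hu]; abel
        have e2 : ω.getD (j + 1) 0 = ω.getD j 0 + w := by rw [hw]; abel
        rw [e1, e2, huv, hwv, sub_eq_add_neg]
      have := getD_injOn_of_mem_triSL hω (show j - 1 < N + 1 by omega) (show j + 1 < N + 1 by omega) heq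
      omega
    · exfalso; rw [hgu] at hle_in; omega

/-- **An interior maximum exists in the class**: if some vertex of `ω ∈ S_N(x)` is higher (for `F.g`) than both endpoints
`0` and `x`, the height is maximal at an interior vertex, so `exists_apex` applies.
[cite: MadrasSlade1993, Lemma 7.3.3 (proof: "ω(j) is not an endpoint of ω")] -/
theorem exists_ins (hω : ω ∈ triSLx N x) (hbig : ∃ i ≤ N, max 0 (F.g x) < F.g (ω.getD i 0)) :
    ∃ p : ℕ × Site 2, p ∈ triSlots ω ∧ ∀ i ≤ N, F.g (ω.getD i 0) < F.g p.2 := by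
  obtain ⟨hωS, hωx⟩ := mem_triSLx.1 hω
  obtain ⟨i₀, hi₀, hbig⟩ := hbig
  -- an index maximising the height
  obtain ⟨j, hj, hjmax⟩ := Finset.exists_max_image (Finset.range (N + 1)) (fun i => F.g (ω.getD i 0))
    ⟨0, by simp⟩
  rw [Finset.mem_range] at hj
  have hmax : ∀ i ≤ N, F.g (ω.getD i 0) ≤ F.g (ω.getD j 0) := fun i hi =>
    hjmax i (Finset.mem_range.2 (by omega))
  have hj_ge := lt_of_lt_of_le hbig (hmax i₀ hi₀)
  have hj0 : 0 < j := by
    rcases Nat.eq_zero_or_pos j with h | h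
    · exfalso
      rw [h, getD_zero_of_mem_triSL hωS, map_zero] at hj_ge
      exact absurd (le_max_left 0 (F.g x)) (not_le.2 hj_ge)
    · exact h
  have hjN : j < N := by
    rcases (show j ≤ N by omega).lt_or_eq with h | h
    · exact h
    · exfalso
      rw [h, hωx] at hj_ge
      exact absurd (le_max_right 0 (F.g x)) (not_le.2 hj_ge)
  exact exists_apex F hωS hj0 hjN hmax

/-! ### The insertion map on a class, and its injectivity -/

open Classical in
/-- The class of `F`: walks of `S_N(x)` with a vertex higher (for `F.g`) than both endpoints.
[cite: MadrasSlade1993, Lemma 7.3.3 (proof)] -/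
def cls (N : ℕ) (x : Site 2) : Finset (List (Site 2)) :=
  (triSLx N x).filter fun ω => ∃ i ≤ N, max 0 (F.g x) < F.g (ω.getD i 0)

/-- Membership in `cls`. [cite: MadrasSlade1993, Lemma 7.3.3 (proof)] -/
theorem mem_cls : ω ∈ cls F N x ↔ ω ∈ triSLx N x ∧ ∃ i ≤ N, max 0 (F.g x) < F.g (ω.getD i 0) := by
  classical
  exact Finset.mem_filter

open Classical in
/-- The insertion map: on the class, insert the free apex; elsewhere the identity.
[cite: MadrasSlade1993, Lemma 7.3.3 (proof: the walk ω*)] -/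
def ins (N : ℕ) (x : Site 2) (ω : List (Site 2)) : List (Site 2) :=
  if h : ω ∈ triSLx N x ∧ ∃ i ≤ N, max 0 (F.g x) < F.g (ω.getD i 0) then
    triIns (Classical.choose (exists_ins F h.1 h.2)).1 (Classical.choose (exists_ins F h.1 h.2)).2 ω
  else ω

/-- On the class, `ins` inserts a slot apex higher than every vertex. [cite: MadrasSlade1993, Lemma 7.3.3 (proof)] -/
theorem ins_spec (h : ω ∈ cls F N x) :
    ∃ p : ℕ × Site 2, p ∈ triSlots ω ∧ (∀ i ≤ N, F.g (ω.getD i 0) < F.g p.2) ∧ ins F N x ω = triIns p.1 p.2 ω := by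
  classical
  have h' : ω ∈ triSLx N x ∧ ∃ i ≤ N, max 0 (F.g x) < F.g (ω.getD i 0) := (mem_cls F).1 h
  refine ⟨Classical.choose (exists_ins F h'.1 h'.2), (Classical.choose_spec (exists_ins F h'.1 h'.2)).1,
    (Classical.choose_spec (exists_ins F h'.1 h'.2)).2, ?_⟩
  rw [ins, dif_pos h']

/-- The image of the class lies in `S_{N+1}(x)` (the insertion is interior, so the endpoint is kept).
[cite: MadrasSlade1993, Lemma 7.3.3 (proof: "ω* … has the same endpoints as ω")] -/
theorem ins_mem (h : ω ∈ cls F N x) : ins F N x ω ∈ triSLx (N + 1) x := by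
  obtain ⟨⟨m, z⟩, hs, -, he⟩ := ins_spec F h
  obtain ⟨hω, -⟩ := (mem_cls F).1 h
  obtain ⟨hωS, hωx⟩ := mem_triSLx.1 hω
  have hl := length_of_mem_triSL hωS
  obtain ⟨hm, -, -, -⟩ := mem_triSlots.1 hs
  rw [he]
  refine mem_triSLx.2 ⟨triIns_mem_triSL hωS hs, ?_⟩
  dsimp only
  rw [getD_triIns_of_lt (by omega : m + 1 < N + 1), Nat.add_sub_cancel, hωx]

/-- **Injectivity on the class**: the inserted apex is the unique highest vertex of the image, so its position, and
then the original walk (`triDel`), are determined.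
[cite: MadrasSlade1993, Lemma 7.3.3 (proof: "the two added points … are unambiguously determined")] -/
theorem ins_injOn : Set.InjOn (ins F N x) ↑(cls F N x) := by
  intro ω hω ω' hω' heq
  rw [Finset.mem_coe] at hω hω'
  obtain ⟨⟨m, z⟩, hs, htop, he⟩ := ins_spec F hω
  obtain ⟨⟨m', z'⟩, hs', htop', he'⟩ := ins_spec F hω'
  have hωS := (mem_triSLx.1 ((mem_cls F).1 hω).1).1
  have hω'S := (mem_triSLx.1 ((mem_cls F).1 hω').1).1
  have hl := length_of_mem_triSL hωS
  have hl' := length_of_mem_triSL hω'S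
  obtain ⟨hm, -, -, -⟩ := mem_triSlots.1 hs
  obtain ⟨hm', -, -, -⟩ := mem_triSlots.1 hs'
  dsimp only at he he' htop htop' hm hm'
  rw [he, he'] at heq
  -- heights in the common image: position `m+1` carries `z`, every other position `≤ N+1` an `ω`-vertex
  have hval : ∀ i ≤ N + 1, i ≠ m + 1 → ∃ i' ≤ N, (triIns m z ω).getD i 0 = ω.getD i' 0 := by
    intro i hi hne
    rcases Nat.lt_or_gt_of_ne hne with hlt | hgt
    · exact ⟨i, by omega, getD_triIns_of_le (by omega)⟩
    · exact ⟨i - 1, by omega, getD_triIns_of_lt hgt⟩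
  have hval' : ∀ i ≤ N + 1, i ≠ m' + 1 → ∃ i' ≤ N, (triIns m' z' ω').getD i 0 = ω'.getD i' 0 := by
    intro i hi hne
    rcases Nat.lt_or_gt_of_ne hne with hlt | hgt
    · exact ⟨i, by omega, getD_triIns_of_le (by omega)⟩
    · exact ⟨i - 1, by omega, getD_triIns_of_lt hgt⟩
  have hmm : m = m' := by
    by_contra hne
    -- position `m'+1` of the image: it is `z'`, and (read in the first description) an `ω`-vertex
    obtain ⟨i', hi', e1⟩ := hval (m' + 1) (by omega) (by omega)
    rw [heq, getD_triIns_self (by omega)] at e1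
    -- position `m+1`: it is `z`, and an `ω'`-vertex
    obtain ⟨i'', hi'', e2⟩ := hval' (m + 1) (by omega) (by omega)
    rw [← heq, getD_triIns_self (by omega)] at e2
    have h1 := htop i' hi'
    have h2 := htop' i'' hi''
    rw [← e1] at h1
    rw [← e2] at h2
    omega
  subst hmm
  have := congrArg (triDel m) heq
  rwa [triDel_triIns, triDel_triIns] at this

/-- **Each class injects into `S_{N+1}(x)`**: `#cls_F ≤ #S_{N+1}(x)`. [cite: MadrasSlade1993, Lemma 7.3.3] -/
theorem card_cls_le (N : ℕ) (x : Site 2) : #(cls F N x) ≤ #(triSLx (N + 1) x) :=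
  Finset.card_le_card_of_injOn (ins F N x) (fun _ hω => Finset.mem_coe.2 (ins_mem F (Finset.mem_coe.1 hω)))
    (ins_injOn F)

end TriEndpointMono

open TriEndpointMono

/-! ### The cover by the four classes, and the count -/

/-- The two brick heights determine the site. [cite: Grimmett2018, §5.5] -/
private theorem site_eq_of_heights {s t : Site 2} (h1 : gH1 s = gH1 t) (h2 : gH2 s = gH2 t) : s = t := by
  simp only [gH1_apply, gH2_apply] at h1 h2
  exact site_eq (by omega) (by omega)

/-- **Leaving the box**: a self-avoiding walk of `𝕋` with more than `(2A+1)²` vertices has a vertex with `|h₁| > A` or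
`|h₂| > A`. [cite: MadrasSlade1993, Lemma 7.3.3 (proof: "at least one point of ω must lie outside the cube")] -/
theorem exists_height_gt {N : ℕ} {A : ℕ} {ω : List (Site 2)} (hω : ω ∈ triSL N) (hN : (2 * A + 1) ^ 2 < N + 1) :
    ∃ i ≤ N, (A : ℤ) < |gH1 (ω.getD i 0)| ∨ (A : ℤ) < |gH2 (ω.getD i 0)| := by
  classical
  by_contra hcon
  push Not at hcon
  -- the heights map `[0, N]` injectively into the box `[-A, A]²`
  have hinj : Set.InjOn (fun i => (gH1 (ω.getD i 0), gH2 (ω.getD i 0))) ↑(Finset.range (N + 1)) := by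
    intro i hi j hj h
    rw [Finset.mem_coe, Finset.mem_range] at hi hj
    simp only [Prod.mk.injEq] at h
    exact getD_injOn_of_mem_triSL hω hi hj (site_eq_of_heights h.1 h.2)
  have hmaps : Set.MapsTo (fun i => (gH1 (ω.getD i 0), gH2 (ω.getD i 0))) ↑(Finset.range (N + 1))
      ↑(Finset.Icc (-(A : ℤ)) A ×ˢ Finset.Icc (-(A : ℤ)) A) := by
    intro i hi
    rw [Finset.mem_coe, Finset.mem_range] at hi
    obtain ⟨h1, h2⟩ := hcon i (by omega)
    rw [Finset.mem_coe, Finset.mem_product, Finset.mem_Icc, Finset.mem_Icc]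
    exact ⟨abs_le.1 h1, abs_le.1 h2⟩
  have hcard := Finset.card_le_card_of_injOn _ hmaps hinj
  rw [Finset.card_range, Finset.card_product, Int.card_Icc, sub_neg_eq_add] at hcard
  have e : ((A : ℤ) + 1 + A).toNat = 2 * A + 1 := by omega
  rw [e] at hcard
  exact absurd hN (not_lt.2 (by nlinarith [hcard]))

/-- **Cover**: for `(2A+1)² < N + 1`, `A = max(|h₁(x)|, |h₂(x)|)`, every walk of `S_N(x)` lies in one of the four classes.
[cite: MadrasSlade1993, Lemma 7.3.3 (proof)] -/
theorem triSLx_subset_union_cls (N : ℕ) (x : Site 2)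
    (hN : (2 * max (gH1 x).natAbs (gH2 x).natAbs + 1) ^ 2 < N + 1) :
    triSLx N x ⊆ cls frameH1 N x ∪ cls frameH1neg N x ∪ cls frameH2 N x ∪ cls frameH2neg N x := by
  classical
  intro ω hω
  have hωS := (mem_triSLx.1 hω).1
  set A : ℕ := max (gH1 x).natAbs (gH2 x).natAbs with hA
  have hA1 : |gH1 x| ≤ (A : ℤ) := by rw [hA]; push_cast; rw [← Int.natCast_natAbs]; exact_mod_cast le_max_left _ _
  have hA2 : |gH2 x| ≤ (A : ℤ) := by rw [hA]; push_cast; rw [← Int.natCast_natAbs]; exact_mod_cast le_max_right _ _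
  obtain ⟨i, hi, h⟩ := exists_height_gt hωS hN
  simp only [Finset.mem_union, mem_cls]
  have hA0 : (0 : ℤ) ≤ A := Nat.cast_nonneg _
  rcases h with h | h
  · rcases lt_or_ge (gH1 (ω.getD i 0)) 0 with hneg | hpos
    · -- frame `−h₁`
      refine Or.inl (Or.inl (Or.inr ⟨hω, i, hi, ?_⟩))
      show max 0 ((-gH1) x) < (-gH1) (ω.getD i 0)
      simp only [AddMonoidHom.neg_apply]
      rw [abs_of_neg hneg] at h
      have := neg_abs_le (gH1 x)
      exact max_lt (by omega) (by linarith [hA1])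
    · refine Or.inl (Or.inl (Or.inl ⟨hω, i, hi, ?_⟩))
      show max 0 (gH1 x) < gH1 (ω.getD i 0)
      rw [abs_of_nonneg hpos] at h
      exact max_lt (by omega) (by linarith [le_abs_self (gH1 x)])
  · rcases lt_or_ge (gH2 (ω.getD i 0)) 0 with hneg | hpos
    · refine Or.inr ⟨hω, i, hi, ?_⟩
      show max 0 ((-gH2) x) < (-gH2) (ω.getD i 0)
      simp only [AddMonoidHom.neg_apply]
      rw [abs_of_neg hneg] at h
      have := neg_abs_le (gH2 x)
      exact max_lt (by omega) (by linarith [hA2])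
    · refine Or.inl (Or.inr ⟨hω, i, hi, ?_⟩)
      show max 0 (gH2 x) < gH2 (ω.getD i 0)
      rw [abs_of_nonneg hpos] at h
      exact max_lt (by omega) (by linarith [le_abs_self (gH2 x)])

/-- **`#S_N(x) ≤ 4 · #S_{N+1}(x)` on `𝕋` for `(2A+1)² < N + 1`**, `A = max(|2x₀+x₁|, |x₀+2x₁|)` — the one-step version of
Madras–Slade Lemma 7.3.3 for the triangular lattice. [cite: MadrasSlade1993, Lemma 7.3.3] -/
theorem card_triSLx_le_four_mul (N : ℕ) (x : Site 2)
    (hN : (2 * max (gH1 x).natAbs (gH2 x).natAbs + 1) ^ 2 < N + 1) :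
    #(triSLx N x) ≤ 4 * #(triSLx (N + 1) x) := by
  classical
  have h := Finset.card_le_card (triSLx_subset_union_cls N x hN)
  have h1 := card_cls_le frameH1 N x
  have h2 := card_cls_le frameH1neg N x
  have h3 := card_cls_le frameH2 N x
  have h4 := card_cls_le frameH2neg N x
  calc #(triSLx N x) ≤ #(cls frameH1 N x ∪ cls frameH1neg N x ∪ cls frameH2 N x ∪ cls frameH2neg N x) := h
    _ ≤ #(cls frameH1 N x ∪ cls frameH1neg N x ∪ cls frameH2 N x) + #(cls frameH2neg N x) := card_union_le _ _
    _ ≤ #(cls frameH1 N x ∪ cls frameH1neg N x) + #(cls frameH2 N x) + #(cls frameH2neg N x) := by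
        gcongr; exact card_union_le _ _
    _ ≤ #(cls frameH1 N x) + #(cls frameH1neg N x) + #(cls frameH2 N x) + #(cls frameH2neg N x) := by
        gcongr; exact card_union_le _ _
    _ ≤ 4 * #(triSLx (N + 1) x) := by omega

/-- The `∃ N₀` form: **for every `x` there is `N₀` with `#S_N(x) ≤ 4 · #S_{N+1}(x)` for all `N ≥ N₀`** — hypothesis (ii) of
Madras–Slade Lemma 7.3.1 (`liminf φ_N > 0`, here `φ_N ≥ 1/4`) for the fixed-endpoint counts of `𝕋`.
[cite: MadrasSlade1993, Lemma 7.3.3 and Lemma 7.3.1 (ii)] -/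
theorem exists_card_triSLx_le_four_mul (x : Site 2) :
    ∃ N₀ : ℕ, ∀ N : ℕ, N₀ ≤ N → #(triSLx N x) ≤ 4 * #(triSLx (N + 1) x) :=
  ⟨(2 * max (gH1 x).natAbs (gH2 x).natAbs + 1) ^ 2, fun N hN => card_triSLx_le_four_mul N x (by omega)⟩

end Literature.Probability.RandomPlanarGeometry.SAW
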